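import Literature.Computability.QuantumComplexity.HaarUnitaryHidingProofs
import Literature.Probability.RandomMatrix.HaarCornerDensity
import Mathlib.Analysis.Matrix.Spectrum
import Mathlib.Analysis.Matrix.PosDef
import Mathlib.MeasureTheory.Measure.Haar.Unique
import HarnessLib

/-!
# The density of truncated Haar unitaries: discharge of `truncatedHaarDensity`

Companion to `HaarUnitaryHidingProofs.lean` (same namespace), which vendors AA13 eq. (5.5) —
Réffy / Petz–Réffy / Collins: for `m ≥ 2n` the law `𝒮_{m,n}` of `√m` times the top-left `n × n`
block of a Haar-random `U ∈ U(m)` has density `c_{m,n} ∏ᵢ (1 - λᵢ/m)^{m-2n} 𝟙_{λᵢ ≤ m}` with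
respect to Lebesgue measure, `λᵢ` the squared singular values — as the named fact
`truncatedHaarDensity` [cite: AaronsonArkhipovToC2013, §5.1 eq. (5.5)]. This file **proves it**
(`truncatedHaarDensity_holds`) from the law of a corner of a Haar unitary,
`Literature.Probability.RandomMatrix.map_haarCorner_eq_withDensity` [cite: Collins2005, Thm. 5.1]
(proved in `Literature/Probability/RandomMatrix/HaarCornerDensity.lean` by the Gram–Schmidt column
induction): the `n × n` corner `A` (columns `aⱼ ∈ ℂⁿ`) of a Haar unitary has density
`c · det(1 - ∑ⱼ aⱼ aⱼ*)^{m-2n} 𝟙_{1 - ∑ⱼ aⱼ aⱼ* > 0}` for some `c > 0`.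

## The transfer

* `scaledTruncation n h = Ξ ∘ haarCorner m h h` for the real-linear isomorphism
  `Ξ = cornerToArray n √m : (Fin n → ℂⁿ) ≃ (Fin n → Fin n → ℂ)`, `(Ξ A) i j = √m · (A j) i`; a linear
  isomorphism maps Lebesgue measure to a *positive multiple* of Lebesgue measure (uniqueness of
  Haar measure, `isAddLeftInvariant_eq_smul`) — the multiple is absorbed in the unspecified
  constant, so no Jacobian is computed (`map_cornerToArray_volume`);
* with `Y = Matrix.of X`: `1 - ∑ⱼ aⱼ aⱼ* = m⁻¹ (m - Y Y*)` at `A = Ξ⁻¹ X` (`gramCompl_cornerToArray_symm`);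
  for square `Y`, `det (t - Y Y*) = det (t - Y* Y)` and `t - Y Y* > 0 ⟺ t - Y* Y > 0`
  (`det_one_sub_mul_comm`; Schur complements of `[[t, Y], [Y*, 1]]`, `posDef_smul_one_sub_mul_comm`);
  for Hermitian `H` with eigenvalues `λᵢ`: `det (t - H) = ∏ (t - λᵢ)`, `t - H > 0 ⟺ ∀ i, λᵢ < t`,
  `t - H ≥ 0 ⟺ ∀ i, λᵢ ≤ t` (`IsHermitian.charpoly_eq`, `posDef_iff_eigenvalues_pos`, spectrum shift);
* the indicators `𝟙_{∀ λᵢ < m}` (corner density) and `𝟙_{∀ λᵢ ≤ m}` (AA13) disagree only on the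
  level set `N_m = {λ_max = m}` (and only when `m = 2n`; otherwise the factor `(1 - m/m)^{m-2n} = 0`
  reconciles them), which is Lebesgue-null: the `N_t` are pairwise disjoint, `s · N_t ⊆ N_{s²t}`
  has measure `s^{2n²} vol N_t ≥ vol N_t` for `s ≥ 1`, and `N_t ⊆ {‖X‖ ≤ √t}`; countably many
  disjoint dilates in a ball force `vol N_m = 0` (`volume_levelSet_eq_zero`).
-/

noncomputable section

open MeasureTheory ProbabilityTheory Set Module Matrix Metric
open Literature.Probability.RandomMatrix Literature.LinearAlgebra.Matrix
open Literature.MathematicalPhysics.QuantumFieldTheory (haarProbability)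
open scoped ENNReal NNReal ComplexOrder MatrixOrder Polynomial Pointwise

namespace Literature.Computability.QuantumComplexity

variable {n : ℕ}

/-! ### Hermitian matrices: `t·1 - H` through the eigenvalues of `H` -/

section Hermitian

/-- `det (t·1 - H) = ∏ᵢ (t - λᵢ)` for Hermitian `H`: the characteristic polynomial `∏ (X - λᵢ)`
evaluated at `t`. [folklore] -/
theorem det_smul_one_sub_eq_prod {H : Matrix (Fin n) (Fin n) ℂ} (hH : H.IsHermitian) (t : ℝ) :
    ((t : ℂ) • (1 : Matrix (Fin n) (Fin n) ℂ) - H).det = ∏ i, ((t : ℂ) - hH.eigenvalues i) := by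
  have h := Matrix.eval_charpoly H (t : ℂ)
  rw [hH.charpoly_eq, Polynomial.eval_prod] at h
  simp only [Polynomial.eval_sub, Polynomial.eval_X, Polynomial.eval_C] at h
  rw [smul_one_eq_diagonal, ← Matrix.scalar_apply, ← h]
  rfl

/-- `t·1 - A` is Hermitian for Hermitian `A` and real `t`. [folklore] -/
theorem isHermitian_smul_one_sub {A : Matrix (Fin n) (Fin n) ℂ} (hA : A.IsHermitian) (t : ℝ) :
    ((t : ℂ) • (1 : Matrix (Fin n) (Fin n) ℂ) - A).IsHermitian := by
  refine IsHermitian.sub ?_ hA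
  rw [smul_one_eq_diagonal]
  exact isHermitian_diagonal_iff.2 fun _ => by simp [IsSelfAdjoint, Complex.conj_ofReal]

/-- The spectrum of `t·1 - H` is `{t} - {λᵢ}`. [folklore] -/
theorem spectrum_smul_one_sub {H : Matrix (Fin n) (Fin n) ℂ} (hH : H.IsHermitian) (t : ℝ) :
    spectrum ℂ ((t : ℂ) • (1 : Matrix (Fin n) (Fin n) ℂ) - H) =
      ({(t : ℂ)} : Set ℂ) - ((RCLike.ofReal : ℝ → ℂ) '' Set.range hH.eigenvalues) := by
  rw [← hH.spectrum_eq_image_range, spectrum.singleton_sub_eq, Algebra.algebraMap_eq_smul_one]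

/-- Every eigenvalue of `t·1 - H` is `t - λⱼ` for some eigenvalue `λⱼ` of `H`. [folklore] -/
theorem eigenvalues_smul_one_sub_mem {H : Matrix (Fin n) (Fin n) ℂ} (hH : H.IsHermitian) (t : ℝ) (i : Fin n) :
    ∃ j, (isHermitian_smul_one_sub hH t).eigenvalues i = t - hH.eigenvalues j := by
  have hmem := (isHermitian_smul_one_sub hH t).eigenvalues_mem_spectrum_real i
  have hmemC : (((isHermitian_smul_one_sub hH t).eigenvalues i : ℝ) : ℂ) ∈
      spectrum ℂ ((t : ℂ) • (1 : Matrix (Fin n) (Fin n) ℂ) - H) := by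
    rw [(isHermitian_smul_one_sub hH t).spectrum_eq_image_range]
    exact ⟨_, ⟨i, rfl⟩, rfl⟩
  rw [spectrum_smul_one_sub hH t, Set.singleton_sub] at hmemC
  obtain ⟨_, ⟨_, ⟨j, rfl⟩, rfl⟩, hj⟩ := hmemC
  refine ⟨j, ?_⟩
  have : ((t : ℂ) - (hH.eigenvalues j : ℂ)) = (((isHermitian_smul_one_sub hH t).eigenvalues i : ℝ) : ℂ) := hj
  exact_mod_cast this.symm

/-- Every `t - λⱼ` is an eigenvalue of `t·1 - H`. [folklore] -/
theorem sub_eigenvalues_mem {H : Matrix (Fin n) (Fin n) ℂ} (hH : H.IsHermitian) (t : ℝ) (j : Fin n) :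
    ∃ i, (isHermitian_smul_one_sub hH t).eigenvalues i = t - hH.eigenvalues j := by
  have hmemC : ((t : ℂ) - (hH.eigenvalues j : ℂ)) ∈ spectrum ℂ ((t : ℂ) • (1 : Matrix (Fin n) (Fin n) ℂ) - H) := by
    rw [spectrum_smul_one_sub hH t, Set.singleton_sub]
    exact ⟨_, ⟨_, ⟨j, rfl⟩, rfl⟩, rfl⟩
  rw [(isHermitian_smul_one_sub hH t).spectrum_eq_image_range] at hmemC
  obtain ⟨_, ⟨i, rfl⟩, hi⟩ := hmemC
  refine ⟨i, ?_⟩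
  have : (((isHermitian_smul_one_sub hH t).eigenvalues i : ℝ) : ℂ) = ((t : ℂ) - (hH.eigenvalues j : ℂ)) := hi
  exact_mod_cast this

/-- `t·1 - H > 0 ⟺ ∀ i, λᵢ < t`. [folklore] -/
theorem posDef_smul_one_sub_iff {H : Matrix (Fin n) (Fin n) ℂ} (hH : H.IsHermitian) (t : ℝ) :
    ((t : ℂ) • (1 : Matrix (Fin n) (Fin n) ℂ) - H).PosDef ↔ ∀ i, hH.eigenvalues i < t := by
  rw [(isHermitian_smul_one_sub hH t).posDef_iff_eigenvalues_pos]
  constructor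
  · intro h j
    obtain ⟨i, hi⟩ := sub_eigenvalues_mem hH t j
    have := h i
    rw [hi] at this
    linarith
  · intro h i
    obtain ⟨j, hj⟩ := eigenvalues_smul_one_sub_mem hH t i
    rw [hj]
    linarith [h j]

/-- `t·1 - H ≥ 0 ⟺ ∀ i, λᵢ ≤ t`. [folklore] -/
theorem posSemidef_smul_one_sub_iff {H : Matrix (Fin n) (Fin n) ℂ} (hH : H.IsHermitian) (t : ℝ) :
    ((t : ℂ) • (1 : Matrix (Fin n) (Fin n) ℂ) - H).PosSemidef ↔ ∀ i, hH.eigenvalues i ≤ t := by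
  rw [(isHermitian_smul_one_sub hH t).posSemidef_iff_eigenvalues_nonneg, Pi.le_def]
  simp only [Pi.zero_apply]
  constructor
  · intro h j
    obtain ⟨i, hi⟩ := sub_eigenvalues_mem hH t j
    have := h i
    rw [hi] at this
    linarith
  · intro h i
    obtain ⟨j, hj⟩ := eigenvalues_smul_one_sub_mem hH t i
    rw [hj]
    linarith [h j]

end Hermitian

/-! ### Square matrices: `t·1 - Y Y*` versus `t·1 - Y* Y` -/

section Square

/-- `det (t·1 - Y Y*) = det (t·1 - Y* Y)` for square `Y` (`det (1 - AB) = det (1 - BA)`).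
[folklore] -/
theorem det_smul_one_sub_mul_comm (Y : Matrix (Fin n) (Fin n) ℂ) {t : ℂ} (ht : t ≠ 0) :
    (t • (1 : Matrix (Fin n) (Fin n) ℂ) - Y * Yᴴ).det = (t • (1 : Matrix (Fin n) (Fin n) ℂ) - Yᴴ * Y).det := by
  have h1 : t • (1 : Matrix (Fin n) (Fin n) ℂ) - Y * Yᴴ = t • (1 - (t⁻¹ • Y) * Yᴴ) := by
    rw [smul_sub, Matrix.smul_mul, smul_smul, mul_inv_cancel₀ ht, one_smul]
  have h2 : t • (1 : Matrix (Fin n) (Fin n) ℂ) - Yᴴ * Y = t • (1 - Yᴴ * (t⁻¹ • Y)) := by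
    rw [smul_sub, Matrix.mul_smul, smul_smul, mul_inv_cancel₀ ht, one_smul]
  rw [h1, h2, det_smul, det_smul, det_one_sub_mul_comm]

/-- `t·1 > 0` for `t > 0`. [folklore] -/
theorem posDef_real_smul_one {t : ℝ} (ht : 0 < t) : ((t : ℂ) • (1 : Matrix (Fin n) (Fin n) ℂ)).PosDef := by
  rw [smul_one_eq_diagonal]
  exact posDef_diagonal_iff.2 fun _ => Complex.zero_lt_real.2 ht

/-- `(t·1)⁻¹ = t⁻¹·1`. [folklore] -/
theorem inv_real_smul_one {t : ℝ} (ht : t ≠ 0) :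
    ((t : ℂ) • (1 : Matrix (Fin n) (Fin n) ℂ))⁻¹ = (t : ℂ)⁻¹ • (1 : Matrix (Fin n) (Fin n) ℂ) := by
  refine Matrix.inv_eq_left_inv ?_
  rw [smul_mul_smul_comm, Matrix.one_mul, inv_mul_cancel₀ (Complex.ofReal_ne_zero.2 ht), one_smul]

/-- `t·1 - Y Y* ≥ 0 ⟺ t·1 - Y* Y ≥ 0` for square `Y` and `t > 0`: both are the positivity of
the block matrix `[[t·1, Y], [Y*, 1]]` (Schur complements). [folklore] -/
theorem posSemidef_smul_one_sub_mul_comm (Y : Matrix (Fin n) (Fin n) ℂ) {t : ℝ} (ht : 0 < t) :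
    ((t : ℂ) • (1 : Matrix (Fin n) (Fin n) ℂ) - Y * Yᴴ).PosSemidef ↔
      ((t : ℂ) • (1 : Matrix (Fin n) (Fin n) ℂ) - Yᴴ * Y).PosSemidef := by
  have hA := posDef_real_smul_one (n := n) ht
  letI : Invertible ((t : ℂ) • (1 : Matrix (Fin n) (Fin n) ℂ)) := hA.isUnit.invertible
  letI : Invertible (1 : Matrix (Fin n) (Fin n) ℂ) := invertibleOne
  have h₂ := PosDef.fromBlocks₂₂ ((t : ℂ) • (1 : Matrix (Fin n) (Fin n) ℂ)) Y (PosDef.one (n := Fin n) (R := ℂ))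
  have h₁ := PosDef.fromBlocks₁₁ Y (1 : Matrix (Fin n) (Fin n) ℂ) hA
  rw [inv_one, Matrix.mul_one] at h₂
  rw [inv_real_smul_one ht.ne', Matrix.mul_smul, Matrix.mul_one, Matrix.smul_mul] at h₁
  rw [← h₂, h₁]
  -- `1 - t⁻¹ Yᴴ Y ≥ 0 ⟺ t - Yᴴ Y ≥ 0`
  have ht0 : (0 : ℂ) ≤ (t : ℂ) := (Complex.zero_lt_real.2 ht).le
  have ht0' : (0 : ℂ) ≤ ((t : ℂ))⁻¹ := by
    rw [← Complex.ofReal_inv]; exact Complex.zero_le_real.2 (inv_nonneg.2 ht.le)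
  have hscale : (t : ℂ) • ((1 : Matrix (Fin n) (Fin n) ℂ) - (t : ℂ)⁻¹ • (Yᴴ * Y)) =
      (t : ℂ) • 1 - Yᴴ * Y := by
    rw [smul_sub, smul_smul, mul_inv_cancel₀ (Complex.ofReal_ne_zero.2 ht.ne'), one_smul]
  have hscale' : ((t : ℂ))⁻¹ • ((t : ℂ) • (1 : Matrix (Fin n) (Fin n) ℂ) - Yᴴ * Y) =
      1 - (t : ℂ)⁻¹ • (Yᴴ * Y) := by
    rw [smul_sub, smul_smul, inv_mul_cancel₀ (Complex.ofReal_ne_zero.2 ht.ne'), one_smul]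
  constructor
  · intro h
    have := h.smul ht0
    rwa [hscale] at this
  · intro h
    have := h.smul ht0'
    rwa [hscale'] at this

/-- `t·1 - Y Y* > 0 ⟺ t·1 - Y* Y > 0` for square `Y` and `t > 0` (positive semidefinite with
non-zero, equal, determinants). [folklore] -/
theorem posDef_smul_one_sub_mul_comm (Y : Matrix (Fin n) (Fin n) ℂ) {t : ℝ} (ht : 0 < t) :
    ((t : ℂ) • (1 : Matrix (Fin n) (Fin n) ℂ) - Y * Yᴴ).PosDef ↔
      ((t : ℂ) • (1 : Matrix (Fin n) (Fin n) ℂ) - Yᴴ * Y).PosDef := by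
  constructor
  · intro h
    have hpsd := (posSemidef_smul_one_sub_mul_comm Y ht).1 h.posSemidef
    refine hpsd.posDef_iff_det_ne_zero.2 ?_
    rw [← det_smul_one_sub_mul_comm Y (Complex.ofReal_ne_zero.2 ht.ne')]
    exact h.det_pos.ne'
  · intro h
    have hpsd := (posSemidef_smul_one_sub_mul_comm Y ht).2 h.posSemidef
    refine hpsd.posDef_iff_det_ne_zero.2 ?_
    rw [det_smul_one_sub_mul_comm Y (Complex.ofReal_ne_zero.2 ht.ne')]
    exact h.det_pos.ne'

end Square

/-! ### The null level sets `{λ_max = t}` -/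

section Null

/-- `X* X` for a square array `X` (its eigenvalues are the `sqSingularValue X i`). [folklore] -/
def gramArr (X : Fin n → Fin n → ℂ) : Matrix (Fin n) (Fin n) ℂ := (Matrix.of X)ᴴ * Matrix.of X

/-- `X* X` is Hermitian. [folklore] -/
theorem isHermitian_gramArr (X : Fin n → Fin n → ℂ) : (gramArr X).IsHermitian :=
  isHermitian_conjTranspose_mul_self _

/-- The **level set `{λ_max(X* X) = t}`**, written as `t·1 - X* X ≥ 0 ∧ det (t·1 - X* X) = 0`.
[folklore] -/
def levelSet (n : ℕ) (t : ℝ) : Set (Fin n → Fin n → ℂ) :=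
  {X | ((t : ℂ) • (1 : Matrix (Fin n) (Fin n) ℂ) - gramArr X).PosSemidef ∧
    ((t : ℂ) • (1 : Matrix (Fin n) (Fin n) ℂ) - gramArr X).det = 0}

/-- `t·1 - X* X` is Hermitian. [folklore] -/
theorem isHermitian_smul_one_sub_gramArr (t : ℝ) (X : Fin n → Fin n → ℂ) :
    ((t : ℂ) • (1 : Matrix (Fin n) (Fin n) ℂ) - gramArr X).IsHermitian := by
  refine IsHermitian.sub ?_ (isHermitian_gramArr X)
  rw [smul_one_eq_diagonal]
  exact isHermitian_diagonal_iff.2 fun _ => by simp [IsSelfAdjoint, Complex.conj_ofReal]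

/-- `X ↦ X* X` is continuous. [folklore] -/
theorem continuous_gramArr : Continuous (gramArr (n := n)) := by
  unfold gramArr
  refine Continuous.matrix_mul (Continuous.matrix_conjTranspose continuous_id) continuous_id

/-- The level sets are closed. [folklore] -/
theorem isClosed_levelSet (t : ℝ) : IsClosed (levelSet n t) := by
  have hcont : Continuous fun X : Fin n → Fin n → ℂ =>
      (t : ℂ) • (1 : Matrix (Fin n) (Fin n) ℂ) - gramArr X :=
    continuous_const.sub continuous_gramArr
  have h1 : {X : Fin n → Fin n → ℂ | ((t : ℂ) • (1 : Matrix (Fin n) (Fin n) ℂ) - gramArr X).PosSemidef} =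
      {X | ∀ v : Fin n → ℂ, 0 ≤ star v ⬝ᵥ ((t : ℂ) • (1 : Matrix (Fin n) (Fin n) ℂ) - gramArr X) *ᵥ v} := by
    ext X
    exact ⟨fun h => h.dotProduct_mulVec_nonneg,
      fun h => PosSemidef.of_dotProduct_mulVec_nonneg (isHermitian_smul_one_sub_gramArr t X) h⟩
  have h0 : IsClosed {z : ℂ | 0 ≤ z} := by
    have : {z : ℂ | 0 ≤ z} = Complex.re ⁻¹' Ici 0 ∩ Complex.im ⁻¹' {0} := by
      ext z; simp [Complex.nonneg_iff, eq_comm]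
    rw [this]
    exact (isClosed_Ici.preimage Complex.continuous_re).inter
      ((isClosed_singleton).preimage Complex.continuous_im)
  have hpsd : IsClosed {X : Fin n → Fin n → ℂ |
      ((t : ℂ) • (1 : Matrix (Fin n) (Fin n) ℂ) - gramArr X).PosSemidef} := by
    rw [h1]
    simp only [setOf_forall]
    refine isClosed_iInter fun v => h0.preimage ?_
    simp only [dotProduct, mulVec]
    refine continuous_finsetSum _ fun i _ => continuous_const.mul
      (continuous_finsetSum _ fun k _ => Continuous.mul ?_ continuous_const)
    exact (continuous_apply_apply i k).comp hcont
  exact hpsd.inter ((isClosed_singleton).preimage (hcont.matrix_det))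

/-- **Different level sets are disjoint**: an eigenvector for the eigenvalue `t'` of `X* X`
violates `t·1 - X* X ≥ 0` when `t < t'`. [folklore] -/
theorem levelSet_disjoint {t t' : ℝ} (htt' : t < t') : Disjoint (levelSet n t) (levelSet n t') := by
  rw [Set.disjoint_left]
  rintro X ⟨hpsd, -⟩ ⟨-, hdet⟩
  obtain ⟨v, hv0, hv⟩ := Matrix.exists_mulVec_eq_zero_iff.2 hdet
  have hHv : gramArr X *ᵥ v = (t' : ℂ) • v := by
    rw [sub_mulVec, smul_mulVec, one_mulVec, sub_eq_zero] at hv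
    exact hv.symm
  have h := hpsd.dotProduct_mulVec_nonneg v
  rw [sub_mulVec, smul_mulVec, one_mulVec, hHv, ← sub_smul, dotProduct_smul] at h
  have hpos : 0 < star v ⬝ᵥ v := Matrix.dotProduct_star_self_pos_iff.2 hv0
  obtain ⟨r, hr0, hr⟩ : ∃ r : ℝ, 0 < r ∧ star v ⬝ᵥ v = (r : ℂ) := by
    have hre := Complex.pos_iff.1 hpos
    exact ⟨(star v ⬝ᵥ v).re, hre.1, Complex.ext (by simp) (by simp [← hre.2])⟩
  rw [← Complex.ofReal_sub, smul_eq_mul, hr, ← Complex.ofReal_mul, Complex.zero_le_real] at h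
  nlinarith

/-- Real scaling of the array scales `X* X` by `s²`. [folklore] -/
theorem gramArr_smul (s : ℝ) (X : Fin n → Fin n → ℂ) :
    gramArr (s • X) = ((s ^ 2 : ℝ) : ℂ) • gramArr X := by
  have hof : Matrix.of (s • X) = (s : ℂ) • Matrix.of X := by
    ext i j; simp [Complex.real_smul]
  unfold gramArr
  rw [hof, conjTranspose_smul, smul_mul_smul_comm, Complex.star_def, Complex.conj_ofReal]
  push_cast
  ring_nf

/-- Scaling by `s > 0` maps the level set at `t` into the level set at `s² t`. [folklore] -/
theorem smul_mem_levelSet {t s : ℝ} (hs : 0 < s) {X : Fin n → Fin n → ℂ} (hX : X ∈ levelSet n t) :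
    s • X ∈ levelSet n (s ^ 2 * t) := by
  obtain ⟨hpsd, hdet⟩ := hX
  have hfac : (((s ^ 2 * t : ℝ)) : ℂ) • (1 : Matrix (Fin n) (Fin n) ℂ) - gramArr (s • X) =
      ((s ^ 2 : ℝ) : ℂ) • (((t : ℂ)) • (1 : Matrix (Fin n) (Fin n) ℂ) - gramArr X) := by
    rw [gramArr_smul, smul_sub, smul_smul]
    push_cast
    ring_nf
  refine ⟨?_, ?_⟩
  · rw [hfac]
    exact hpsd.smul (Complex.zero_le_real.2 (by positivity))
  · rw [hfac, det_smul, hdet, mul_zero]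

/-- Level sets are bounded: on `{λ_max = t}` every entry has modulus `≤ √t` (diagonal of
`t·1 - X* X ≥ 0`). [folklore] -/
theorem norm_le_of_mem_levelSet {t : ℝ} {X : Fin n → Fin n → ℂ} (hX : X ∈ levelSet n t) :
    ‖X‖ ≤ Real.sqrt t := by
  obtain ⟨hpsd, -⟩ := hX
  refine (pi_norm_le_iff_of_nonneg (Real.sqrt_nonneg t)).2 fun i => ?_
  refine (pi_norm_le_iff_of_nonneg (Real.sqrt_nonneg t)).2 fun j => ?_
  -- diagonal entry `j` of `t - X* X`
  have hdiag := hpsd.diag_nonneg (i := j)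
  have hjj : (gramArr X) j j = ∑ k, (starRingEnd ℂ) (X k j) * X k j := by
    simp [gramArr, Matrix.mul_apply, conjTranspose_apply]
  rw [Matrix.sub_apply, Matrix.smul_apply, Matrix.one_apply_eq, smul_eq_mul, mul_one, hjj] at hdiag
  have hsum : ∑ k, (starRingEnd ℂ) (X k j) * X k j = ((∑ k, ‖X k j‖ ^ 2 : ℝ) : ℂ) := by
    push_cast
    refine Finset.sum_congr rfl fun k _ => ?_
    rw [Complex.conj_mul']
  rw [hsum, ← Complex.ofReal_sub, Complex.zero_le_real, sub_nonneg] at hdiag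
  have hij : ‖X i j‖ ^ 2 ≤ t :=
    (Finset.single_le_sum (fun k _ => sq_nonneg ‖X k j‖) (Finset.mem_univ i)).trans hdiag
  exact Real.le_sqrt_of_sq_le hij


/-- **The level sets `{λ_max = t}` (`t > 0`) are Lebesgue-null**: the dilates `s_k · N_t`,
`s_k = 1 + 1/(k+1)`, are pairwise disjoint (they lie in the distinct level sets `N_{s_k² t}`), each
has measure `s_k^{dim} vol N_t ≥ vol N_t`, and all lie in the ball of radius `√(4t)`; so
`vol N_t > 0` would give a bounded set of infinite measure. [folklore] -/
theorem volume_levelSet_eq_zero {t : ℝ} (ht : 0 < t) :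
    (volume : Measure (Fin n → Fin n → ℂ)) (levelSet n t) = 0 := by
  haveI : MeasurableAdd (Fin n → ℂ) := inferInstance
  haveI : (volume : Measure (Fin n → Fin n → ℂ)).IsAddHaarMeasure := Measure.pi.isAddHaarMeasure _
  by_contra hne
  -- the scales `s k ∈ (1, 2]`
  set s : ℕ → ℝ := fun k => 1 + ((k : ℝ) + 1)⁻¹ with hs
  have hs1 : ∀ k, 1 < s k := fun k => by
    have : (0 : ℝ) < ((k : ℝ) + 1)⁻¹ := by positivity
    simp only [hs]; linarith
  have hs2 : ∀ k, s k ≤ 2 := fun k => by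
    have : ((k : ℝ) + 1)⁻¹ ≤ 1 := inv_le_one_of_one_le₀ (by linarith [(Nat.cast_nonneg k : (0 : ℝ) ≤ k)])
    simp only [hs]; linarith
  have hs0 : ∀ k, 0 < s k := fun k => lt_trans one_pos (hs1 k)
  have hsinj : Function.Injective s := by
    intro a b hab
    have h1 : ((a : ℝ) + 1)⁻¹ = ((b : ℝ) + 1)⁻¹ := add_left_cancel hab
    have h2 : (a : ℝ) + 1 = (b : ℝ) + 1 := inv_injective h1
    exact_mod_cast add_right_cancel h2
  -- the scaled copies
  set S : ℕ → Set (Fin n → Fin n → ℂ) := fun k => s k • levelSet n t with hS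
  have hSsub : ∀ k, S k ⊆ levelSet n (s k ^ 2 * t) := fun k => by
    rintro _ ⟨X, hX, rfl⟩
    exact smul_mem_levelSet (hs0 k) hX
  have hSmeas : ∀ k, MeasurableSet (S k) := fun k => by
    have : S k = (MeasurableEquiv.smul₀ (s k) (hs0 k).ne') '' levelSet n t := by
      simp only [hS, ← Set.image_smul]; rfl
    rw [this, MeasurableEquiv.measurableSet_image]
    exact (isClosed_levelSet t).measurableSet
  have hSdisj : Pairwise (Function.onFun Disjoint S) := by
    intro a b hab
    have hne' : s a ^ 2 * t ≠ s b ^ 2 * t := by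
      intro h
      have h2 : s a ^ 2 = s b ^ 2 := mul_right_cancel₀ ht.ne' h
      have h3 : s a = s b := by
        have := (sq_eq_sq₀ (hs0 a).le (hs0 b).le).1 h2; exact this
      exact hab (hsinj h3)
    rcases lt_or_gt_of_ne hne' with hlt | hgt
    · exact Set.disjoint_of_subset (hSsub a) (hSsub b) (levelSet_disjoint hlt)
    · exact Set.disjoint_of_subset (hSsub a) (hSsub b) (levelSet_disjoint hgt).symm
  -- each copy has measure at least `v`
  have hSvol : ∀ k, (volume : Measure (Fin n → Fin n → ℂ)) (levelSet n t) ≤ volume (S k) := fun k => by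
    rw [hS]
    dsimp only
    rw [Measure.addHaar_smul, abs_of_pos (pow_pos (hs0 k) _)]
    have h1 : (1 : ℝ≥0∞) ≤ ENNReal.ofReal (s k ^ Module.finrank ℝ (Fin n → Fin n → ℂ)) := by
      rw [← ENNReal.ofReal_one]
      exact ENNReal.ofReal_le_ofReal (one_le_pow₀ (hs1 k).le)
    calc (volume : Measure (Fin n → Fin n → ℂ)) (levelSet n t)
        = 1 * volume (levelSet n t) := (one_mul _).symm
      _ ≤ _ := mul_le_mul' h1 le_rfl
  -- all copies lie in a bounded set
  have hSball : ∀ k, S k ⊆ closedBall (0 : Fin n → Fin n → ℂ) (Real.sqrt (4 * t)) := fun k X hX => by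
    rw [mem_closedBall, dist_zero_right]
    have h1 := norm_le_of_mem_levelSet (hSsub k hX)
    refine h1.trans (Real.sqrt_le_sqrt ?_)
    have h4 : s k ^ 2 ≤ 4 := by nlinarith [hs2 k, hs0 k]
    nlinarith
  have hfin : (volume : Measure (Fin n → Fin n → ℂ)) (⋃ k, S k) < ⊤ :=
    (measure_mono (iUnion_subset hSball)).trans_lt measure_closedBall_lt_top
  have hinf : (volume : Measure (Fin n → Fin n → ℂ)) (⋃ k, S k) = ⊤ := by
    rw [measure_iUnion hSdisj hSmeas]
    refine eq_top_iff.2 ?_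
    calc (⊤ : ℝ≥0∞) = ∑' _ : ℕ, (volume : Measure (Fin n → Fin n → ℂ)) (levelSet n t) :=
          (ENNReal.tsum_const_eq_top_of_ne_zero hne).symm
      _ ≤ ∑' k, volume (S k) := ENNReal.tsum_le_tsum hSvol
  exact absurd hinf hfin.ne

end Null

/-! ### The linear change of variables `Ξ` -/

section Transfer

variable {m : ℕ}

/-- `Ξ_c : (Fin n → ℂⁿ) ≃ₗ[ℝ] (Fin n → Fin n → ℂ)`, `(Ξ_c A) i j = c · (A j) i` (columns to a scaled
row-major array), for a real `c ≠ 0`. [folklore] -/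
def cornerToArray (n : ℕ) (c : ℝ) (hc : c ≠ 0) :
    (Fin n → EuclideanSpace ℂ (Fin n)) ≃ₗ[ℝ] (Fin n → Fin n → ℂ) where
  toFun A i j := (c : ℂ) * (A j) i
  invFun X j := WithLp.toLp 2 fun i => (c : ℂ)⁻¹ * X i j
  map_add' A B := by
    funext i j
    simp only [Pi.add_apply, PiLp.add_apply, mul_add]
  map_smul' r A := by
    funext i j
    simp only [Pi.smul_apply, PiLp.smul_apply, RingHom.id_apply, Complex.real_smul]
    ring
  left_inv A := by
    funext j
    refine PiLp.ext fun i => ?_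
    change (c : ℂ)⁻¹ * ((c : ℂ) * (A j) i) = (A j) i
    rw [← mul_assoc, inv_mul_cancel₀ (Complex.ofReal_ne_zero.2 hc), one_mul]
  right_inv X := by
    funext i j
    change (c : ℂ) * ((c : ℂ)⁻¹ * X i j) = X i j
    rw [← mul_assoc, mul_inv_cancel₀ (Complex.ofReal_ne_zero.2 hc), one_mul]

/-- Entries of `Ξ_c A`. [folklore] -/
@[simp] theorem cornerToArray_apply (c : ℝ) (hc : c ≠ 0) (A : Fin n → EuclideanSpace ℂ (Fin n))
    (i j : Fin n) : cornerToArray n c hc A i j = (c : ℂ) * (A j) i := rfl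

/-- Coordinates of `Ξ_c⁻¹ X`. [folklore] -/
@[simp] theorem cornerToArray_symm_apply (c : ℝ) (hc : c ≠ 0) (X : Fin n → Fin n → ℂ) (j i : Fin n) :
    (cornerToArray n c hc).symm X j i = (c : ℂ)⁻¹ * X i j := rfl

/-- `Ξ` as a measurable equivalence. [folklore] -/
def arrayEquiv (n : ℕ) (c : ℝ) (hc : c ≠ 0) :
    (Fin n → EuclideanSpace ℂ (Fin n)) ≃ᵐ (Fin n → Fin n → ℂ) :=
  (cornerToArray n c hc).toContinuousLinearEquiv.toHomeomorph.toMeasurableEquiv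

/-- The measurable equivalence is `Ξ_c` as a function. [folklore] -/
theorem arrayEquiv_coe (c : ℝ) (hc : c ≠ 0) : ⇑(arrayEquiv n c hc) = ⇑(cornerToArray n c hc) := rfl

/-- Its inverse is `Ξ_c⁻¹` as a function. [folklore] -/
theorem arrayEquiv_symm_coe (c : ℝ) (hc : c ≠ 0) :
    ⇑(arrayEquiv n c hc).symm = ⇑(cornerToArray n c hc).symm := rfl

/-- `scaledTruncation = Ξ_{√m} ∘ haarCorner`. [folklore] -/
theorem scaledTruncation_eq_comp (h : n ≤ m) (hc : Real.sqrt m ≠ 0) :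
    scaledTruncation n h = cornerToArray n (Real.sqrt m) hc ∘ haarCorner m h h := by
  funext U i j
  rfl

/-- **A linear isomorphism maps Lebesgue measure to a positive multiple of Lebesgue measure**
(uniqueness of Haar measure; the constant is not computed). [folklore] -/
theorem map_cornerToArray_volume (c : ℝ) (hc : c ≠ 0) :
    ∃ k : ℝ≥0, 0 < k ∧ (volume : Measure (Fin n → EuclideanSpace ℂ (Fin n))).map (cornerToArray n c hc) =
      k • (volume : Measure (Fin n → Fin n → ℂ)) := by
  haveI : MeasurableAdd (EuclideanSpace ℂ (Fin n)) := inferInstance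
  haveI : (volume : Measure (Fin n → EuclideanSpace ℂ (Fin n))).IsAddHaarMeasure :=
    Measure.pi.isAddHaarMeasure _
  haveI : MeasurableAdd (Fin n → ℂ) := inferInstance
  haveI : (volume : Measure (Fin n → Fin n → ℂ)).IsAddHaarMeasure := Measure.pi.isAddHaarMeasure _
  set L := (cornerToArray n c hc).toContinuousLinearEquiv with hL
  have hLc : ⇑L = ⇑(cornerToArray n c hc) := rfl
  haveI : ((volume : Measure (Fin n → EuclideanSpace ℂ (Fin n))).map L).IsAddHaarMeasure :=
    L.isAddHaarMeasure_map _
  refine ⟨Measure.addHaarScalarFactor ((volume : Measure (Fin n → EuclideanSpace ℂ (Fin n))).map L) volume,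
    Measure.addHaarScalarFactor_pos_of_isAddHaarMeasure _ _, ?_⟩
  rw [← hLc]
  exact Measure.isAddLeftInvariant_eq_smul _ _

/-- **The Gram complement after the change of variables**: at `A = Ξ⁻¹ X`,
`1 - ∑ⱼ aⱼ aⱼ* = m⁻¹ • (m·1 - Y Y*)` with `Y = Matrix.of X`. [folklore] -/
theorem gramCompl_cornerToArray_symm (hm : 0 < m) (hc : Real.sqrt m ≠ 0) (X : Fin n → Fin n → ℂ) :
    gramCompl ((cornerToArray n (Real.sqrt m) hc).symm X) =
      ((m : ℝ) : ℂ)⁻¹ • ((((m : ℝ) : ℂ)) • (1 : Matrix (Fin n) (Fin n) ℂ) - Matrix.of X * (Matrix.of X)ᴴ) := by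
  have hmm : ((Real.sqrt m : ℝ) : ℂ)⁻¹ * (starRingEnd ℂ) ((Real.sqrt m : ℝ) : ℂ)⁻¹ = ((m : ℝ) : ℂ)⁻¹ := by
    rw [Complex.conj_inv, Complex.conj_ofReal, ← mul_inv, ← Complex.ofReal_mul,
      Real.mul_self_sqrt (Nat.cast_nonneg m)]
  have hm0 : ((m : ℝ) : ℂ) ≠ 0 := Complex.ofReal_ne_zero.2 (Nat.cast_pos.2 hm).ne'
  ext i i'
  simp only [gramCompl, oneSubGram, Matrix.sub_apply, Matrix.sum_apply, vecMulVec_apply, Pi.star_apply,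
    cornerToArray_symm_apply, Matrix.smul_apply, smul_eq_mul, Matrix.mul_apply, conjTranspose_apply,
    Matrix.of_apply, Complex.star_def, map_mul]
  have hsum : ∑ j, ((Real.sqrt m : ℝ) : ℂ)⁻¹ * X i j * ((starRingEnd ℂ) ((Real.sqrt m : ℝ) : ℂ)⁻¹ *
      (starRingEnd ℂ) (X i' j)) = ((m : ℝ) : ℂ)⁻¹ * ∑ j, X i j * (starRingEnd ℂ) (X i' j) := by
    rw [Finset.mul_sum]
    refine Finset.sum_congr rfl fun j _ => ?_
    rw [← hmm]; ring
  rw [hsum, mul_sub, ← mul_assoc, inv_mul_cancel₀ hm0, one_mul]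

end Transfer

/-! ### Pointwise identification of the densities off the null level set -/

section Pointwise

variable {m : ℕ}

/-- The corner density transported by `Ξ⁻¹` agrees with `truncatedHaarShape` off the level set
`N_m = {λ_max = m}`. [folklore] -/
theorem cornerDensity_cornerToArray_symm (hm : 0 < m) (hc : Real.sqrt m ≠ 0) (X : Fin n → Fin n → ℂ)
    (hX : X ∉ levelSet n m) :
    cornerDensity (m - n - n) ((cornerToArray n (Real.sqrt m) hc).symm X) = truncatedHaarShape m n X := by
  set Y : Matrix (Fin n) (Fin n) ℂ := Matrix.of X with hY
  have hH : (Yᴴ * Y).IsHermitian := isHermitian_conjTranspose_mul_self Y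
  have hmR : (0 : ℝ) < m := Nat.cast_pos.2 hm
  have hm0 : ((m : ℝ) : ℂ) ≠ 0 := Complex.ofReal_ne_zero.2 hmR.ne'
  have hG := gramCompl_cornerToArray_symm (n := n) hm hc X
  -- positivity of the transported Gram complement
  have hpos_iff : (gramCompl ((cornerToArray n (Real.sqrt m) hc).symm X)).PosDef ↔
      ∀ i, hH.eigenvalues i < m := by
    rw [hG, ← posDef_smul_one_sub_iff hH, ← posDef_smul_one_sub_mul_comm Y hmR]
    have hinv : (0 : ℂ) < ((m : ℝ) : ℂ)⁻¹ := by
      rw [← Complex.ofReal_inv]; exact Complex.zero_lt_real.2 (inv_pos.2 hmR)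
    constructor
    · intro h
      have := h.smul (Complex.zero_lt_real.2 hmR)
      rwa [smul_smul, mul_inv_cancel₀ hm0, one_smul] at this
    · intro h
      exact h.smul hinv
  -- the determinant of the transported Gram complement
  have hdet : (gramCompl ((cornerToArray n (Real.sqrt m) hc).symm X)).det.re =
      ∏ i, (1 - hH.eigenvalues i / m) := by
    rw [hG, det_smul, det_smul_one_sub_mul_comm Y hm0, det_smul_one_sub_eq_prod hH, Fintype.card_fin]
    have h1 : ((m : ℝ) : ℂ)⁻¹ ^ n * ∏ i, (((m : ℝ) : ℂ) - (hH.eigenvalues i : ℂ)) =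
        ∏ i, (((m : ℝ) : ℂ)⁻¹ * (((m : ℝ) : ℂ) - (hH.eigenvalues i : ℂ))) := by
      rw [Finset.prod_mul_distrib, Finset.prod_const, Finset.card_univ, Fintype.card_fin]
    rw [h1]
    have h2 : ∏ i, (((m : ℝ) : ℂ)⁻¹ * (((m : ℝ) : ℂ) - (hH.eigenvalues i : ℂ))) =
        ((∏ i, (1 - hH.eigenvalues i / m) : ℝ) : ℂ) := by
      push_cast
      refine Finset.prod_congr rfl fun i _ => ?_
      field_simp
    rw [h2, Complex.ofReal_re]
  -- `sqSingularValue X = hH.eigenvalues`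
  have hsv : ∀ i, sqSingularValue X i = hH.eigenvalues i := fun i => rfl
  unfold cornerDensity truncatedHaarShape
  simp only [hsv]
  by_cases hlt : ∀ i, hH.eigenvalues i < m
  · rw [if_pos (hpos_iff.2 hlt), if_pos (fun i => (hlt i).le), hdet, ← Finset.prod_pow]
    have he : m - n - n = m - 2 * n := by omega
    rw [he]
  · rw [if_neg (fun h => hlt (hpos_iff.1 h))]
    by_cases hle : ∀ i, hH.eigenvalues i ≤ m
    · exfalso
      refine hX ⟨?_, ?_⟩
      · exact (posSemidef_smul_one_sub_iff hH m).2 hle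
      · change ((((m : ℕ) : ℝ) : ℂ) • (1 : Matrix (Fin n) (Fin n) ℂ) - Yᴴ * Y).det = 0
        rw [det_smul_one_sub_eq_prod hH]
        push Not at hlt
        obtain ⟨i, hi⟩ := hlt
        have heq : hH.eigenvalues i = m := le_antisymm (hle i) hi
        refine Finset.prod_eq_zero (Finset.mem_univ i) ?_
        rw [heq, sub_self]
    · rw [if_neg hle]

end Pointwise

/-! ### The discharge -/

section Main

/-- **AA13 eq. (5.5) / Réffy / Petz–Réffy / Collins, proved.** For `n ≤ m` with `2n ≤ m`, the law
of `√m · U_{n×n}` for Haar `U ∈ U(m)` has density `c ∏ᵢ (1 - λᵢ/m)^{m-2n} 𝟙_{∀ i, λᵢ ≤ m}` with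
respect to Lebesgue measure on `Fin n → Fin n → ℂ`, for some constant `c`.
[cite: AaronsonArkhipovToC2013, §5.1 eq. (5.5)] [cite: Collins2005, Thm. 5.1] -/
theorem truncatedHaarDensity_holds : truncatedHaarDensity := by
  intro m n h h2
  rcases Nat.eq_zero_or_pos n with hn | hn
  · -- `n = 0`: both sides are the Dirac mass on the one-point space
    subst hn
    refine ⟨1, ?_⟩
    have hshape : ∀ X : Fin 0 → Fin 0 → ℂ, truncatedHaarShape m 0 X = 1 := fun X => by
      unfold truncatedHaarShape
      rw [if_pos (fun i => Fin.elim0 i), Finset.univ_eq_empty, Finset.prod_empty]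
    simp_rw [one_mul, hshape, ENNReal.ofReal_one]
    rw [show (fun _ : Fin 0 → Fin 0 → ℂ => (1 : ℝ≥0∞)) = 1 from rfl, withDensity_one]
    have hvol : (volume : Measure (Fin 0 → Fin 0 → ℂ)) = Measure.dirac default := by
      rw [volume_pi, Measure.pi_of_empty _ default]
    haveI : IsProbabilityMeasure (truncatedHaarMeasure m 0 h) := by
      unfold truncatedHaarMeasure
      exact Measure.isProbabilityMeasure_map (continuous_scaledTruncation 0 h).measurable.aemeasurable
    rw [hvol]
    ext s hs
    by_cases h0 : (default : Fin 0 → Fin 0 → ℂ) ∈ s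
    · have hs' : s = univ := by
        ext x; simp only [mem_univ, iff_true]; rwa [Subsingleton.elim x default]
      rw [hs', measure_univ, measure_univ]
    · have hs' : s = ∅ := by
        ext x; simp only [mem_empty_iff_false, iff_false]; rwa [Subsingleton.elim x default]
      rw [hs', measure_empty, measure_empty]
  · have hm : 0 < m := by omega
    have hmR : (0 : ℝ) < m := Nat.cast_pos.2 hm
    have hc : Real.sqrt m ≠ 0 := (Real.sqrt_pos.2 hmR).ne'
    obtain ⟨c, hc0, hcorner⟩ := map_haarCorner_eq_withDensity (m := m) h h (by omega)
    obtain ⟨k, hk0, hk⟩ := map_cornerToArray_volume (n := n) (Real.sqrt m) hc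
    refine ⟨(k : ℝ) * c, ?_⟩
    unfold truncatedHaarMeasure
    rw [ENNReal.smul_def] at hk
    rw [scaledTruncation_eq_comp h hc, ← arrayEquiv_coe,
      ← Measure.map_map (arrayEquiv n (Real.sqrt m) hc).measurable (continuous_haarCorner h h).measurable,
      hcorner, map_withDensity_equiv, arrayEquiv_coe, hk, withDensity_smul_measure,
      ← withDensity_smul' _ _ ENNReal.coe_ne_top]
    refine withDensity_congr_ae ?_
    have hN := volume_levelSet_eq_zero (n := n) hmR
    filter_upwards [compl_mem_ae_iff.2 hN] with X hX
    rw [Pi.smul_apply, Function.comp_apply, arrayEquiv_symm_coe,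
      cornerDensity_cornerToArray_symm hm hc X hX, smul_eq_mul, ← ENNReal.ofReal_coe_nnreal,
      ← ENNReal.ofReal_mul NNReal.zero_le_coe, mul_assoc]

end Main

end Literature.Computability.QuantumComplexity
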